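import Mathlib.Topology.MetricSpace.Pseudo.Lemmas
import Summits.AtomisticToContinuum.BoseEinsteinCondensation.Theorems.BECRewardDescentRewardChordBoundFreeRegionSpreadingHelpers
import Summits.AtomisticToContinuum.BoseEinsteinCondensation.Theorems.BECRewardDescentRewardChordBoundFreeRegionSpreadingGeometry
-- module: Summits.AtomisticToContinuum.BoseEinsteinCondensation.Theorems.BECRewardDescentRewardChordBoundFreeRegionSpreading

/-!
# Stub R3 `stub_freeRegionSpreading` of crux `RewardChordBound` (stmt-AtomisticToContinuum-12876):
# spreading of slot-saturated sets over the free region of `(ℝ/ℤ)^{N×3}`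

Let `Z ⊆ (ℝ/ℤ)^{N×3}` be measurable, `b ≥ 0` with the parking room `2N · (4π/3) b³ < 1`, and suppose that
for every slot `i` and a.e. `t ∈ Z ∩ U₀(b)` (`U₀(b)` the free region, all nearest-image pair distances `> b`)
the translate `t + σᵢ c` lies in `Z` for a.e. `c ∈ (ℝ/ℤ)³`. Then `Z ∩ U₀(b)` is null or `U₀(b) \ Z` is null
(`spreading`, and verbatim the registered statement `stub_freeRegionSpreading`).

Proof (helpers `…FreeRegionSpreadingHelpers`, `…FreeRegionSpreadingGeometry`): the hypothesis says
`ℙ((U₀ ∩ Z) \ hullᵢ Z) = 0` for the slot hulls `hullᵢ Z = {t | t + σᵢ c ∈ Z a.e. c}`. If both `Z ∩ U₀` and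
`U₀ \ Z` had positive measure, second countability gives a point `X ∈ Z ∩ U₀` all of whose neighbourhoods meet `Z`
in positive measure and a point `Y ∈ U₀ \ Z` all of whose neighbourhoods meet `Zᶜ` in positive measure
(`exists_mem_forall_mem_nhdsWithin_pos_measure`). A parking chain of one-slot moves through `U₀` joins `X` to `Y`
(`exists_chain`); transporting along it (`measure_ball_transport`, for all small radii at once) shows that the
balls `B(X, ε)` and `B(Y, ε)` carry the same mass of `Z`, so the free coordinate box `B(Y, ε) ⊆ U₀` meets both
`Z` and `Zᶜ` in positive measure — contradicting the box dichotomy (`box_dichotomy`).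
-/

noncomputable section

open MeasureTheory Filter Set Function Metric
open scoped ENNReal NNReal Topology
open Literature.Analysis.FunctionSpaces
open Literature.MathematicalPhysics.QuantumManyBody.BoseGas

namespace Summit.AtomisticToContinuum.BoseEinsteinCondensation.Cruxes.RewardChordBound.Birth.FreeRegionSpreading

section Main

/-- **Free-region spreading** (the registered statement with named hypotheses): a measurable `Z` saturated along
one-slot translations at its points of the free region is null or conull there (the measure-theoretic ergodicity
step of the Perron–Frobenius argument). [cite: ReedSimonIV1978, Thm XIII.44 (ergodicity step)] -/
theorem spreading (N : ℕ) (b : ℝ) (Z : Set (UnitAddTorus (Fin N × Fin 3))) (hZ : MeasurableSet Z) (hb : 0 ≤ b)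
    (hroom : 2 * (N : ℝ) * (4 / 3 * Real.pi * b ^ 3) < 1)
    (hH : ∀ i : Fin N, ∀ᵐ t ∂(Measure.pi fun _ : Fin N × Fin 3 => (AddCircle.haarAddCircle : Measure UnitAddCircle)),
      t ∈ Z → t ∈ {t : UnitAddTorus (Fin N × Fin 3) | ∀ j l : Fin N, j ≠ l → b < Torus.pairDist j l t} →
        ∀ᵐ c ∂(Measure.pi fun _ : Fin 3 => (AddCircle.haarAddCircle : Measure UnitAddCircle)),
          t + slotShift i c ∈ Z) :
    Measure.pi (fun _ : Fin N × Fin 3 => (AddCircle.haarAddCircle : Measure UnitAddCircle))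
        (Z ∩ {t : UnitAddTorus (Fin N × Fin 3) | ∀ j l : Fin N, j ≠ l → b < Torus.pairDist j l t}) = 0 ∨
      Measure.pi (fun _ : Fin N × Fin 3 => (AddCircle.haarAddCircle : Measure UnitAddCircle))
        ({t : UnitAddTorus (Fin N × Fin 3) | ∀ j l : Fin N, j ≠ l → b < Torus.pairDist j l t} \ Z) = 0 := by
  set U : Set (UnitAddTorus (Fin N × Fin 3)) := {t | ∀ j l : Fin N, j ≠ l → b < Torus.pairDist j l t} with hU
  have hUo : IsOpen U := isOpen_free b
  have hUm : MeasurableSet U := hUo.measurableSet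
  have hHull : ∀ i : Fin N, Measure.pi (fun _ : Fin N × Fin 3 => (AddCircle.haarAddCircle : Measure UnitAddCircle))
      ((U ∩ Z) \ {t : UnitAddTorus (Fin N × Fin 3) |
        ∀ᵐ c ∂(Measure.pi fun _ : Fin 3 => (AddCircle.haarAddCircle : Measure UnitAddCircle)),
          t + slotShift i c ∈ Z}) = 0 := by
    intro i
    rw [measure_eq_zero_iff_ae_notMem]
    filter_upwards [hH i] with t ht
    rintro ⟨⟨htU, htZ⟩, hth⟩
    exact hth (ht htZ htU)
  by_contra hcon
  rw [not_or] at hcon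
  obtain ⟨hZU, hUZ⟩ := hcon
  obtain ⟨X, ⟨hXZ, hXU⟩, hX⟩ := exists_mem_forall_mem_nhdsWithin_pos_measure hZU
  obtain ⟨Y, ⟨hYU, hYZ⟩, hY⟩ := exists_mem_forall_mem_nhdsWithin_pos_measure hUZ
  -- a parking chain from `X` to `Y` through the free region
  obtain ⟨M, C, hC0, hCM, hCU, hCstep⟩ := exists_chain hb hroom hXU hYU
  -- transport of the ball masses along the chain, for all small radii at once
  have key : ∀ m, m ≤ M → ∀ᶠ ε in 𝓝[>] (0 : ℝ),
      Measure.pi (fun _ : Fin N × Fin 3 => (AddCircle.haarAddCircle : Measure UnitAddCircle)) (ball X ε ∩ Z) =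
        Measure.pi (fun _ : Fin N × Fin 3 => (AddCircle.haarAddCircle : Measure UnitAddCircle)) (ball (C m) ε ∩ Z) ∧
      Measure.pi (fun _ : Fin N × Fin 3 => (AddCircle.haarAddCircle : Measure UnitAddCircle)) (ball X ε \ Z) =
        Measure.pi (fun _ : Fin N × Fin 3 => (AddCircle.haarAddCircle : Measure UnitAddCircle)) (ball (C m) ε \ Z) := by
    intro m
    induction m with
    | zero =>
      intro _
      rw [hC0]
      exact Eventually.of_forall fun ε => ⟨rfl, rfl⟩
    | succ m ih =>
      intro hm
      obtain ⟨i, c, hc⟩ := hCstep m (by omega)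
      have e1 : ∀ᶠ ε in 𝓝[>] (0 : ℝ), ball (C m) ε ⊆ U :=
        (eventually_ball_subset (hUo.mem_nhds (hCU m (by omega)))).filter_mono nhdsWithin_le_nhds
      have e2 : ∀ᶠ ε in 𝓝[>] (0 : ℝ), ball (C (m + 1)) ε ⊆ U :=
        (eventually_ball_subset (hUo.mem_nhds (hCU (m + 1) hm))).filter_mono nhdsWithin_le_nhds
      filter_upwards [ih (by omega), e1, e2] with ε hε h1 h2
      rw [hc] at h2 ⊢
      obtain ⟨a1, a2⟩ := measure_ball_transport AddCircle.haarAddCircle hZ hHull i c h1 h2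
      exact ⟨hε.1.trans a1, hε.2.trans a2⟩
  have e3 : ∀ᶠ ε in 𝓝[>] (0 : ℝ), ball Y ε ⊆ U :=
    (eventually_ball_subset (hUo.mem_nhds hYU)).filter_mono nhdsWithin_le_nhds
  obtain ⟨ε, hε0, ⟨hε1, -⟩, hε3⟩ :=
    ((eventually_mem_nhdsWithin (a := (0 : ℝ)) (s := Ioi 0)).and ((key M le_rfl).and e3)).exists
  rw [hCM] at hε1
  have hε : 0 < ε := hε0
  have hposZ : 0 < Measure.pi (fun _ : Fin N × Fin 3 => (AddCircle.haarAddCircle : Measure UnitAddCircle))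
      (ball Y ε ∩ Z) := by
    rw [← hε1]
    refine lt_of_lt_of_le (hX _ (inter_mem_nhdsWithin _ (ball_mem_nhds X hε))) (measure_mono ?_)
    exact fun t ht => ⟨ht.2, ht.1.1⟩
  have hposZc : 0 < Measure.pi (fun _ : Fin N × Fin 3 => (AddCircle.haarAddCircle : Measure UnitAddCircle))
      (ball Y ε \ Z) := by
    refine lt_of_lt_of_le (hY _ (inter_mem_nhdsWithin _ (ball_mem_nhds Y hε))) (measure_mono ?_)
    exact fun t ht => ⟨ht.2, ht.1.2⟩
  -- the free ball around `Y` is a coordinate box: dichotomy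
  have hbox := box_dichotomy AddCircle.haarAddCircle hZ hUm hHull (fun p => ball (Y p) ε)
    (fun _ => measurableSet_ball) (by rw [← ball_pi Y hε]; exact hε3)
  rw [← ball_pi Y hε] at hbox
  rcases hbox with h | h
  · exact hposZ.ne' h
  · exact hposZc.ne' h

end Main

end Summit.AtomisticToContinuum.BoseEinsteinCondensation.Cruxes.RewardChordBound.Birth.FreeRegionSpreading

namespace Summit.AtomisticToContinuum.BoseEinsteinCondensation.Cruxes.RewardChordBound.Birth

/-- **stub R3 — `FreeRegionSpreading`** (pure measure theory on `(ℝ/ℤ)^{N×3}`). Let `Z` be measurable, `b ≥ 0`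
with the parking room `2N·(4π/3)b³ < 1`, and suppose `Z` is saturated along one-slot translations at its points in
the free region `U₀(b) = {t | ∀ j ≠ k, b < ρⱼₖ(t)}`: for every slot `i` and a.e. `t ∈ Z ∩ U₀(b)`,
`t + σᵢ c ∈ Z` for a.e. `c ∈ (ℝ/ℤ)³`. Then `Z ∩ U₀(b)` is null or conull in `U₀(b)` (slot hulls
`hullᵢ Z ⊇ Z ∩ U₀` a.e., `⊆ Z` a.e., exactly `σᵢ`-invariant; cube saturation on coordinate boxes; transport of
ball masses along one-slot moves; parking chains; a point of density of `Z ∩ U₀` and one of `U₀ \ Z` would give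
a free ball that is both: `FreeRegionSpreading.spreading`).
[cite: ReedSimonIV1978, Thm XIII.44 (ergodicity step)] -/
theorem stub_freeRegionSpreading :
    ∀ (N : ℕ) (b : ℝ) (Z : Set (UnitAddTorus (Fin N × Fin 3))), MeasurableSet Z → 0 ≤ b →
      2 * (N : ℝ) * (4 / 3 * Real.pi * b ^ 3) < 1 →
      (∀ i : Fin N, ∀ᵐ t ∂(MeasureTheory.Measure.pi fun _ : Fin N × Fin 3 =>
          (AddCircle.haarAddCircle : MeasureTheory.Measure UnitAddCircle)),
        t ∈ Z → (∀ j k : Fin N, j ≠ k → b < Literature.Analysis.FunctionSpaces.Torus.pairDist j k t) →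
          ∀ᵐ c ∂(MeasureTheory.Measure.pi fun _ : Fin 3 => (AddCircle.haarAddCircle : MeasureTheory.Measure UnitAddCircle)),
            t + Literature.MathematicalPhysics.QuantumManyBody.BoseGas.slotShift i c ∈ Z) →
      (MeasureTheory.Measure.pi fun _ : Fin N × Fin 3 => (AddCircle.haarAddCircle : MeasureTheory.Measure UnitAddCircle))
          (Z ∩ {t | ∀ j k : Fin N, j ≠ k → b < Literature.Analysis.FunctionSpaces.Torus.pairDist j k t}) = 0 ∨
      (MeasureTheory.Measure.pi fun _ : Fin N × Fin 3 => (AddCircle.haarAddCircle : MeasureTheory.Measure UnitAddCircle))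
          ({t | ∀ j k : Fin N, j ≠ k → b < Literature.Analysis.FunctionSpaces.Torus.pairDist j k t} \ Z) = 0 :=
  fun N b Z hZ hb hroom hH => FreeRegionSpreading.spreading N b Z hZ hb hroom hH

end Summit.AtomisticToContinuum.BoseEinsteinCondensation.Cruxes.RewardChordBound.Birth

end
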